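import Summits.NavierStokesRegularity.NavierStokesRegularity.Theorems.OddMorawetzLocal.Negative.OddMorawetzLocalJetAlgebra
import HarnessLib

/-!
# Crux `OddMorawetzLocal` (stmt-NavierStokesRegularity-1376) — the evaluation semantics of the jet algebra

Support file for the refutation skeleton of `OddMorawetzLocal` (line `registered`, lead c1), registered stub
`evalA_algebra`.  Mathlib `List` API only; no named facts; nothing is defined.

The refutation computes with sparse jet polynomials `JPoly R = List (R × List JVar)` (lists of
(coefficient, monomial)) in the kernel and transports the results to analysis through the semantics
`JPoly.evalA p ζ = Σ_{(c, m) ∈ p} c · Π_{v ∈ m} ζ v` (value at an assignment `ζ : JVar → ℝ` of the jet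
variables).  This file is the algebraic half of that bridge: `evalA` is a "ring homomorphism" from the list
algebra of `OddMorawetzLocalJetAlgebra.lean` to `ℝ`,

* `evalA_append`   — concatenation is addition;
* `evalA_smul`, `evalA_neg` — scalar multiples and negation;
* `evalA_mul`      — the all-pairs product `JPoly.mul` is multiplication (induction on the left factor,
  `List.flatMap_cons`, `List.prod_append`);
* `evalA_prodList` — `JPoly.prodList` is the product of the values;
* `evalA_map_sortVars` — sorting the variables of every monomial does not change the value
  (`insertVar v ws` is a permutation of `v :: ws`, hence `sortVars m` is a permutation of `m`, and
  `List.Perm.prod_eq`);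
* `evalA_subst`    — substitution followed by evaluation is evaluation at the substituted values;

assembled into the registered seven-part conjunction `evalA_algebra`.
-/

noncomputable section

set_option linter.dupNamespace false
set_option autoImplicit false

namespace Summit.NavierStokesRegularity.NavierStokesRegularity.Theorems.OddMorawetz

/-! ### Unfolding `evalA` on `[]` and `t :: p` -/

/-- The empty polynomial evaluates to `0`. -/
private theorem evalA_nil' (ζ : JVar → ℝ) : JPoly.evalA [] ζ = 0 := by
  simp [JPoly.evalA]

/-- `evalA` of `t :: p` is the value of the term `t` plus `evalA p`. -/
private theorem evalA_cons' (t : ℝ × List JVar) (p : JPoly ℝ) (ζ : JVar → ℝ) :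
    JPoly.evalA (t :: p) ζ = t.1 * (t.2.map ζ).prod + JPoly.evalA p ζ := by
  simp [JPoly.evalA]

/-! ### Addition, scalar multiplication, negation -/

/-- **Concatenation is addition**: `evalA (p ++ q) = evalA p + evalA q`. -/
theorem evalA_append (p q : JPoly ℝ) (ζ : JVar → ℝ) :
    JPoly.evalA (p ++ q) ζ = JPoly.evalA p ζ + JPoly.evalA q ζ := by
  simp [JPoly.evalA, List.map_append, List.sum_append]

/-- **Scalar multiples**: `evalA (smul c p) = c * evalA p`. -/
theorem evalA_smul (c : ℝ) (p : JPoly ℝ) (ζ : JVar → ℝ) :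
    JPoly.evalA (JPoly.smul c p) ζ = c * JPoly.evalA p ζ := by
  induction p with
  | nil => simp [JPoly.smul, JPoly.evalA]
  | cons t p ih =>
    have h : JPoly.smul c (t :: p) = (c * t.1, t.2) :: JPoly.smul c p := rfl
    rw [h, evalA_cons', evalA_cons', ih]
    ring

/-- **Negation**: `evalA (neg p) = - evalA p`. -/
theorem evalA_neg (p : JPoly ℝ) (ζ : JVar → ℝ) :
    JPoly.evalA (JPoly.neg p) ζ = -JPoly.evalA p ζ := by
  induction p with
  | nil => simp [JPoly.neg, JPoly.evalA]
  | cons t p ih =>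
    have h : JPoly.neg (t :: p) = (-t.1, t.2) :: JPoly.neg p := rfl
    rw [h, evalA_cons', evalA_cons', ih]
    ring

/-! ### Multiplication and finite products -/

/-- One left term times a polynomial: `evalA (q.map ((c, m) · -)) = c · Π m · evalA q`. -/
private theorem evalA_map_mulTerm (s : ℝ × List JVar) (q : JPoly ℝ) (ζ : JVar → ℝ) :
    JPoly.evalA (q.map fun t => (s.1 * t.1, s.2 ++ t.2)) ζ = s.1 * (s.2.map ζ).prod * JPoly.evalA q ζ := by
  induction q with
  | nil => simp [JPoly.evalA]
  | cons t q ih =>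
    rw [List.map_cons, evalA_cons', evalA_cons', ih, List.map_append, List.prod_append]
    ring

/-- **The all-pairs product is multiplication**: `evalA (mul p q) = evalA p * evalA q`. -/
theorem evalA_mul (p q : JPoly ℝ) (ζ : JVar → ℝ) :
    JPoly.evalA (JPoly.mul p q) ζ = JPoly.evalA p ζ * JPoly.evalA q ζ := by
  induction p with
  | nil => simp [JPoly.mul, JPoly.evalA]
  | cons s p ih =>
    have h : JPoly.mul (s :: p) q = (q.map fun t => (s.1 * t.1, s.2 ++ t.2)) ++ JPoly.mul p q := by
      simp only [JPoly.mul, List.flatMap_cons]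
    rw [h, evalA_append, evalA_map_mulTerm, ih, evalA_cons']
    ring

/-- **Finite products**: `evalA (prodList ps) = Π_{p ∈ ps} evalA p`. -/
theorem evalA_prodList (ps : List (JPoly ℝ)) (ζ : JVar → ℝ) :
    JPoly.evalA (JPoly.prodList ps) ζ = (ps.map fun p => JPoly.evalA p ζ).prod := by
  induction ps with
  | nil => simp [JPoly.prodList, JPoly.evalA]
  | cons p ps ih => rw [JPoly.prodList, evalA_mul, ih, List.map_cons, List.prod_cons]

/-! ### Sorting the variables of a monomial -/

/-- Sorted insertion permutes: `insertVar v ws ~ v :: ws`. -/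
private theorem perm_insertVar (v : JVar) (ws : List JVar) : (insertVar v ws).Perm (v :: ws) := by
  induction ws with
  | nil => exact List.Perm.refl _
  | cons w ws ih =>
    simp only [insertVar]
    split
    · exact (ih.cons w).trans (List.Perm.swap v w ws)
    · exact List.Perm.refl _

/-- Sorting permutes: `sortVars m ~ m`. -/
private theorem perm_sortVars (m : List JVar) : (sortVars m).Perm m := by
  induction m with
  | nil => exact List.Perm.refl _
  | cons v m ih =>
    show (insertVar v (sortVars m)).Perm (v :: m)
    exact (perm_insertVar v _).trans (ih.cons v)

/-- The monomial product is blind to sorting: `Π (sortVars m).map ζ = Π m.map ζ`. -/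
private theorem prod_map_sortVars (m : List JVar) (ζ : JVar → ℝ) : ((sortVars m).map ζ).prod = (m.map ζ).prod :=
  ((perm_sortVars m).map ζ).prod_eq

/-- **Sorting the variables of every monomial does not change the value.** -/
theorem evalA_map_sortVars (p : JPoly ℝ) (ζ : JVar → ℝ) :
    JPoly.evalA (p.map fun t => (t.1, sortVars t.2)) ζ = JPoly.evalA p ζ := by
  induction p with
  | nil => rfl
  | cons t p ih => rw [List.map_cons, evalA_cons', evalA_cons', ih, prod_map_sortVars]

/-! ### Substitution -/

/-- **Substitution then evaluation is evaluation at the substituted values**: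
`evalA (subst σ p) ζ = evalA p (v ↦ evalA (σ v) ζ)`. -/
theorem evalA_subst (σ : JVar → JPoly ℝ) (p : JPoly ℝ) (ζ : JVar → ℝ) :
    JPoly.evalA (JPoly.subst σ p) ζ = JPoly.evalA p (fun v => JPoly.evalA (σ v) ζ) := by
  induction p with
  | nil => simp [JPoly.subst, JPoly.evalA]
  | cons t p ih =>
    have h : JPoly.subst σ (t :: p) =
        JPoly.smul t.1 (JPoly.prodList (t.2.map σ)) ++ JPoly.subst σ p := by
      simp only [JPoly.subst, JPoly.smul, List.flatMap_cons]
    rw [h, evalA_append, evalA_smul, evalA_prodList, ih, evalA_cons', List.map_map]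
    rfl

/-! ### The registered stub -/

/-- **Stub `evalA_algebra` of crux `OddMorawetzLocal`** — the evaluation semantics `JPoly.evalA` turns the list
operations of the computable jet algebra into the ring operations of `ℝ`: concatenation ↦ `+`, `smul c` ↦ `c * ·`,
`neg` ↦ `-`, `mul` ↦ `*`, `prodList` ↦ `List.prod`, it is blind to the order of the variables of a monomial
(`sortVars`), and `subst σ` followed by evaluation at `ζ` is evaluation at `v ↦ evalA (σ v) ζ`. -/
theorem evalA_algebra :
    (∀ (p q : JPoly ℝ) (ζ : JVar → ℝ), JPoly.evalA (p ++ q) ζ = JPoly.evalA p ζ + JPoly.evalA q ζ) ∧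
    (∀ (c : ℝ) (p : JPoly ℝ) (ζ : JVar → ℝ), JPoly.evalA (JPoly.smul c p) ζ = c * JPoly.evalA p ζ) ∧
    (∀ (p : JPoly ℝ) (ζ : JVar → ℝ), JPoly.evalA (JPoly.neg p) ζ = -JPoly.evalA p ζ) ∧
    (∀ (p q : JPoly ℝ) (ζ : JVar → ℝ), JPoly.evalA (JPoly.mul p q) ζ = JPoly.evalA p ζ * JPoly.evalA q ζ) ∧
    (∀ (ps : List (JPoly ℝ)) (ζ : JVar → ℝ), JPoly.evalA (JPoly.prodList ps) ζ = (ps.map fun p => JPoly.evalA p ζ).prod) ∧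
    (∀ (p : JPoly ℝ) (ζ : JVar → ℝ), JPoly.evalA (p.map fun t => (t.1, sortVars t.2)) ζ = JPoly.evalA p ζ) ∧
    (∀ (σ : JVar → JPoly ℝ) (p : JPoly ℝ) (ζ : JVar → ℝ),
      JPoly.evalA (JPoly.subst σ p) ζ = JPoly.evalA p (fun v => JPoly.evalA (σ v) ζ)) :=
  ⟨evalA_append, evalA_smul, evalA_neg, evalA_mul, evalA_prodList, evalA_map_sortVars, evalA_subst⟩

end Summit.NavierStokesRegularity.NavierStokesRegularity.Theorems.OddMorawetz

end
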